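import Summits.Ventures.PercRepro.PuncturedLYMTwoCoHypPos

/-!
# PercRepro — TWO CO-HYPERPLANES OF ANY INTERSECTION, PART 3: THE EXPLICIT FLOW (EQUAL SPLIT) AND ITS ROW
IDENTITIES (p10, gen 35)

Arithmetic only.  `C₁ = A ∪ S`, `C₂ = B ∪ S`, `#A = m₁ − s`, `#B = m₂ − s`, `#S = s`; the superposition of the two
gen-33 flows at the levels `c₁ = a + d`, `c₂ = b + d` (`supA`, `supB`, `supR` of part 3 and `supD` here) has exact rows
and untouched columns; a touched column `(#A, b, s)` of `C₁` has `#A` rows below it via `+A` (the rows `(#A − 1, b, s)`,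
type I) and `s` rows via `+D` (the rows `(#A, b, s − 1)`, type II), and its error is
    gErr b = #A·supA (m₁−1) (b+s) + s·supD (m₁−1) (b+s−1) − twoK,
    (n − j)·gErr b = (j + 1)·δ₂ − #A·f²_{b+s} + s·g²_{b+s−1}   (`gErr_eq`).
THE EQUAL SPLIT: every row below the touched column changes its edge into it by `−gErr b/m₁`; the `+B` edges of the
rows of both types gain `gBeta b = (L − b)·f²_{b+s}/((n − j)·m₁·(#B − b))` and their `+R` edges lose
`−gGamma b = b·f²_{b+s−1}/((n − j)·m₁·(#B + 1 − b))` (`L = j + 1 − m₁`) — the closed forms of part 6 at the level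
`b + s`, scaled by `#A/m₁`; the mirror for `C₂`; the corner row `(#A − 1, #B − 1, s)` (present iff `#A + #B + s = j + 2`)
has its `+A`, `+B` edges forced and its `+R` edges `gCornerR` from the row.
* `sup3_row`, `sup3_col` — the superposition's rows and untouched columns (four edge types);
* `gErr_eq` — the error in deficit form;  `corr_zero` — the correction of a row of either type sums to zero
  (the column identity of `C₂` at `b + s` and its row identity at `b + s − 1`);
* `w3A_symm`, `w3B_symm`, `w3D_symm`, `w3R_symm` — the mirror symmetry;
* **`w3_row`** — every realisable row sums to `1` (the first identity hypothesis of `puncturedNMP_gen_of_seq`).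
For `s = 0` this is the flow of part 6.  Nothing here asserts (SP), (PAV) or (NC).
-/

namespace PercRepro.PuncturedLYM

open Finset

/-- The superposition weight for a point of `S = C₁ ∩ C₂` added: `yv¹_{c₁} + yv²_{c₂} − 1/(n − j)`. -/
def supD (n j m₁ m₂ c₁ c₂ : ℕ) : ℚ := coYv n j m₁ c₁ + coYv n j m₂ c₂ - 1 / ((n - j : ℕ) : ℚ)

/-- The error of the superposition at the touched column `(#A, b, s)` of `C₁`. -/
def gErr (n j m₁ m₂ s b : ℕ) : ℚ :=
  ((m₁ - s : ℕ) : ℚ) * supA n j m₁ m₂ (m₁ - 1) (b + s) + (s : ℚ) * supD n j m₁ m₂ (m₁ - 1) (b + s - 1) -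
    twoK n j m₁ m₂

/-- `gBeta b = (j + 1 − m₁ − b)·f²_{b+s}/((n − j)·m₁·(m₂ − s − b))`: the `+B` correction of the rows below the touched
column `(#A, b, s)` of `C₁`. -/
def gBeta (n j m₁ m₂ s b : ℕ) : ℚ :=
  ((j + 1 - m₁ - b : ℕ) : ℚ) * coF n j m₂ (b + s) / (((n - j : ℕ) : ℚ) * (m₁ : ℚ) * ((m₂ - s - b : ℕ) : ℚ))

/-- `gGamma b = −b·f²_{b+s−1}/((n − j)·m₁·(m₂ − s + 1 − b))`: the `+R` correction of those rows. -/
def gGamma (n j m₁ m₂ s b : ℕ) : ℚ :=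
  -((b : ℚ) * coF n j m₂ (b + s - 1)) / (((n - j : ℕ) : ℚ) * (m₁ : ℚ) * ((m₂ - s + 1 - b : ℕ) : ℚ))

/-- The corner `+R` weight: the row `(#A − 1, #B − 1, s)` with its `+A`, `+B` edges forced. -/
def gCornerR (n j m₁ m₂ s : ℕ) : ℚ :=
  (1 - (supA n j m₁ m₂ (m₁ - 1) (m₂ - 1) - gErr n j m₁ m₂ s (m₂ - s - 1) / (m₁ : ℚ)) -
      (supB n j m₁ m₂ (m₁ - 1) (m₂ - 1) - gErr n j m₂ m₁ s (m₁ - s - 1) / (m₂ : ℚ))) /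
    ((n - m₁ - m₂ + s : ℕ) : ℚ)

/-- The `+A` weight on the profile `(a, b, d)`. -/
def w3A (n j m₁ m₂ s a b d : ℕ) : ℚ :=
  if a + 1 = m₁ - s ∧ d = s then supA n j m₁ m₂ (m₁ - 1) (b + s) - gErr n j m₁ m₂ s b / (m₁ : ℚ)
  else if b + 1 = m₂ - s ∧ d = s then supA n j m₁ m₂ (a + s) (m₂ - 1) + gBeta n j m₂ m₁ s a
  else if b = m₂ - s ∧ d + 1 = s then supA n j m₁ m₂ (a + s - 1) (m₂ - 1) + gBeta n j m₂ m₁ s a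
  else supA n j m₁ m₂ (a + d) (b + d)

/-- The `+B` weight. -/
def w3B (n j m₁ m₂ s a b d : ℕ) : ℚ :=
  if b + 1 = m₂ - s ∧ d = s then supB n j m₁ m₂ (a + s) (m₂ - 1) - gErr n j m₂ m₁ s a / (m₂ : ℚ)
  else if a + 1 = m₁ - s ∧ d = s then supB n j m₁ m₂ (m₁ - 1) (b + s) + gBeta n j m₁ m₂ s b
  else if a = m₁ - s ∧ d + 1 = s then supB n j m₁ m₂ (m₁ - 1) (b + s - 1) + gBeta n j m₁ m₂ s b
  else supB n j m₁ m₂ (a + d) (b + d)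

/-- The `+D` weight (a point of `S` added); the (unrealisable) profiles of type II for both sets are left to the
superposition so that the definition is manifestly symmetric. -/
def w3D (n j m₁ m₂ s a b d : ℕ) : ℚ :=
  if a = m₁ - s ∧ d + 1 = s ∧ b ≠ m₂ - s then supD n j m₁ m₂ (m₁ - 1) (b + s - 1) - gErr n j m₁ m₂ s b / (m₁ : ℚ)
  else if b = m₂ - s ∧ d + 1 = s ∧ a ≠ m₁ - s then supD n j m₁ m₂ (a + s - 1) (m₂ - 1) - gErr n j m₂ m₁ s a / (m₂ : ℚ)
  else supD n j m₁ m₂ (a + d) (b + d)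

/-- The `+R` weight. -/
def w3R (n j m₁ m₂ s a b d : ℕ) : ℚ :=
  if a + 1 = m₁ - s ∧ b + 1 = m₂ - s ∧ d = s then gCornerR n j m₁ m₂ s
  else if a + 1 = m₁ - s ∧ d = s then supR n j m₁ m₂ (m₁ - 1) (b + s) + gGamma n j m₁ m₂ s b
  else if b + 1 = m₂ - s ∧ d = s then supR n j m₁ m₂ (a + s) (m₂ - 1) + gGamma n j m₂ m₁ s a
  else if a = m₁ - s ∧ d + 1 = s ∧ b ≠ m₂ - s then supR n j m₁ m₂ (m₁ - 1) (b + s - 1) + gGamma n j m₁ m₂ s b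
  else if b = m₂ - s ∧ d + 1 = s ∧ a ≠ m₁ - s then supR n j m₁ m₂ (a + s - 1) (m₂ - 1) + gGamma n j m₂ m₁ s a
  else supR n j m₁ m₂ (a + d) (b + d)

/-! ### The mirror symmetry -/

/-- `supD` is symmetric under the mirror. -/
theorem supD_symm (n j m₁ m₂ c₁ c₂ : ℕ) : supD n j m₁ m₂ c₁ c₂ = supD n j m₂ m₁ c₂ c₁ := by
  unfold supD
  ring

/-- `gCornerR` is symmetric in `(m₁, m₂)`. -/
theorem gCornerR_symm (n j m₁ m₂ s : ℕ) : gCornerR n j m₁ m₂ s = gCornerR n j m₂ m₁ s := by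
  unfold gCornerR
  rw [supA_symm n j m₁ m₂, ← supA_symm n j m₂ m₁, show n - m₁ - m₂ + s = n - m₂ - m₁ + s by omega]
  ring

/-- `w3A (m₁, m₂) a b d = w3B (m₂, m₁) b a d`. -/
theorem w3A_symm (n j m₁ m₂ s a b d : ℕ) : w3A n j m₁ m₂ s a b d = w3B n j m₂ m₁ s b a d := by
  unfold w3A w3B
  rw [supA_symm n j m₁ m₂ (m₁ - 1) (b + s), supA_symm n j m₁ m₂ (a + s) (m₂ - 1),
    supA_symm n j m₁ m₂ (a + s - 1) (m₂ - 1), supA_symm n j m₁ m₂ (a + d) (b + d)]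

/-- `w3B (m₁, m₂) a b d = w3A (m₂, m₁) b a d`. -/
theorem w3B_symm (n j m₁ m₂ s a b d : ℕ) : w3B n j m₁ m₂ s a b d = w3A n j m₂ m₁ s b a d := by
  rw [w3A_symm]

/-- `w3D` is symmetric under the mirror. -/
theorem w3D_symm (n j m₁ m₂ s a b d : ℕ) : w3D n j m₁ m₂ s a b d = w3D n j m₂ m₁ s b a d := by
  unfold w3D
  rw [supD_symm n j m₁ m₂ (m₁ - 1) (b + s - 1), supD_symm n j m₁ m₂ (a + s - 1) (m₂ - 1),
    supD_symm n j m₁ m₂ (a + d) (b + d)]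
  split_ifs <;> first | rfl | omega

/-- `w3R` is symmetric under the mirror. -/
theorem w3R_symm (n j m₁ m₂ s a b d : ℕ) : w3R n j m₁ m₂ s a b d = w3R n j m₂ m₁ s b a d := by
  unfold w3R
  rw [gCornerR_symm, supR_symm n j m₁ m₂ (m₁ - 1) (b + s), supR_symm n j m₁ m₂ (a + s) (m₂ - 1),
    supR_symm n j m₁ m₂ (m₁ - 1) (b + s - 1), supR_symm n j m₁ m₂ (a + s - 1) (m₂ - 1),
    supR_symm n j m₁ m₂ (a + d) (b + d)]
  split_ifs <;> first | rfl | omega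

/-! ### The superposition's rows and untouched columns with four edge types -/

/-- `(n − j)·supD c₁ c₂ = 1 + g¹_{c₁} + g²_{c₂}`. -/
theorem supD_eq {n j m₁ m₂ c₁ c₂ : ℕ} (hn : 2 * j + 1 ≤ n) :
    ((n - j : ℕ) : ℚ) * supD n j m₁ m₂ c₁ c₂ = 1 + coG n j m₁ c₁ + coG n j m₂ c₂ := by
  have hr : ((n - j : ℕ) : ℚ) ≠ 0 := by
    exact_mod_cast (show n - j ≠ 0 by omega)
  unfold supD coG
  field_simp
  ring

/-- **The rows of the superposition with four edge types sum to `1`**: on the profile `(a, b, d)` with `c₁ = a + d < m₁`,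
`c₂ = b + d < m₂` (`s ≤ m₁, m₂`, `a ≤ m₁ − s`, `b ≤ m₂ − s`, `d ≤ s`). -/
theorem sup3_row {n j m₁ m₂ s a b d : ℕ} (hm₁ : 1 ≤ m₁) (hm₁j : m₁ ≤ j) (hm₂ : 1 ≤ m₂) (hm₂j : m₂ ≤ j)
    (hn : 2 * j + 1 ≤ n) (hs₁ : s ≤ m₁) (hs₂ : s ≤ m₂) (hc₁ : a + d < m₁) (hc₂ : b + d < m₂) :
    (((m₁ - s : ℕ) : ℚ) - a) * supA n j m₁ m₂ (a + d) (b + d) + (((m₂ - s : ℕ) : ℚ) - b) * supB n j m₁ m₂ (a + d) (b + d) +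
      ((s : ℚ) - d) * supD n j m₁ m₂ (a + d) (b + d) +
      ((n : ℚ) - j - ((m₁ - s : ℕ) : ℚ) - ((m₂ - s : ℕ) : ℚ) - s + a + b + d) * supR n j m₁ m₂ (a + d) (b + d) = 1 := by
  have r1 := coSeq_row hm₁ hm₁j hn hc₁
  have r2 := coSeq_row hm₂ hm₂j hn hc₂
  have hnj : ((n - j : ℕ) : ℚ) = (n : ℚ) - j := by rw [Nat.cast_sub (by omega)]
  have hA : ((m₁ - s : ℕ) : ℚ) = (m₁ : ℚ) - s := by rw [Nat.cast_sub hs₁]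
  have hB : ((m₂ - s : ℕ) : ℚ) = (m₂ : ℚ) - s := by rw [Nat.cast_sub hs₂]
  have hpos : (n : ℚ) - j ≠ 0 := by
    have : (j : ℚ) + 1 ≤ n := by exact_mod_cast (show j + 1 ≤ n by omega)
    linarith
  unfold supA supB supD supR
  rw [hnj, hA, hB]
  push_cast at r1 r2 ⊢
  field_simp
  linear_combination ((n : ℚ) - j) * (r1 + r2)

/-- One flow's share of an untouched column: `a'·yv (a' − 1 + d') + d'·yv (a' + (d' − 1)) + (j + 1 − a' − d')·xv (a' + d') = k`
for `a' + d' < m`. -/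
theorem col_piece {n j m a' d' : ℕ} (hm : 1 ≤ m) (hmj : m ≤ j) (hn : 2 * j + 1 ≤ n) (hc : a' + d' < m) :
    (a' : ℚ) * coYv n j m (a' - 1 + d') + (d' : ℚ) * coYv n j m (a' + (d' - 1)) +
      ((j : ℚ) + 1 - a' - d') * coXv n j m (a' + d') = coK n j m := by
  rcases Nat.eq_zero_or_pos (a' + d') with h0 | hpos
  · have ha : a' = 0 := by omega
    have hd : d' = 0 := by omega
    subst ha hd
    have := coSeq_col0 n j m
    simp only [Nat.cast_zero, zero_mul, zero_add, sub_zero]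
    linarith
  · have hcol := coSeq_col hm hmj hn hpos hc
    have e1 : (a' : ℚ) * coYv n j m (a' - 1 + d') = (a' : ℚ) * coYv n j m (a' + d' - 1) := by
      rcases Nat.eq_zero_or_pos a' with h | h
      · subst h
        simp
      · congr 2
        omega
    have e2 : (d' : ℚ) * coYv n j m (a' + (d' - 1)) = (d' : ℚ) * coYv n j m (a' + d' - 1) := by
      rcases Nat.eq_zero_or_pos d' with h | h
      · subst h
        simp
      · congr 2
        omega
    rw [e1, e2]
    have e3 : ((a' + d' : ℕ) : ℚ) = (a' : ℚ) + d' := by push_cast; ring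
    rw [e3] at hcol
    linear_combination hcol

/-- **The untouched columns of the superposition with four edge types sum to `twoK`** on the profile `(a', b', d')` with
`a' + d' < m₁`, `b' + d' < m₂`. -/
theorem sup3_col {n j m₁ m₂ a' b' d' : ℕ} (hm₁ : 1 ≤ m₁) (hm₁j : m₁ ≤ j) (hm₂ : 1 ≤ m₂) (hm₂j : m₂ ≤ j)
    (hn : 2 * j + 1 ≤ n) (hc₁ : a' + d' < m₁) (hc₂ : b' + d' < m₂) :
    (a' : ℚ) * supA n j m₁ m₂ (a' - 1 + d') (b' + d') + (b' : ℚ) * supB n j m₁ m₂ (a' + d') (b' - 1 + d') +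
      (d' : ℚ) * supD n j m₁ m₂ (a' + (d' - 1)) (b' + (d' - 1)) +
      ((j : ℚ) + 1 - a' - b' - d') * supR n j m₁ m₂ (a' + d') (b' + d') = twoK n j m₁ m₂ := by
  have p1 := col_piece (n := n) (j := j) (m := m₁) (a' := a') (d' := d') hm₁ hm₁j hn hc₁
  have p2 := col_piece (n := n) (j := j) (m := m₂) (a' := b') (d' := d') hm₂ hm₂j hn hc₂
  unfold supA supB supD supR twoK
  linear_combination p1 + p2

/-! ### The error and the correction -/

/-- **The error in deficit form**: `(n − j)·gErr b = (j + 1)·δ₂ − #A·f²_{b+s} + s·g²_{b+s−1}`. -/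
theorem gErr_eq {n j m₁ m₂ s b : ℕ} (hm₁ : 1 ≤ m₁) (hm₁j : m₁ ≤ j) (hn : 2 * j + 1 ≤ n) (hs₁ : s ≤ m₁) :
    ((n - j : ℕ) : ℚ) * gErr n j m₁ m₂ s b =
      ((j : ℚ) + 1) * coDel n j m₂ - ((m₁ - s : ℕ) : ℚ) * coF n j m₂ (b + s) + (s : ℚ) * coG n j m₂ (b + s - 1) := by
  have hA := supA_eq (n := n) (j := j) (m₁ := m₁) (m₂ := m₂) (a := m₁ - 1) (b := b + s) hn
  have hD := supD_eq (n := n) (j := j) (m₁ := m₁) (m₂ := m₂) (c₁ := m₁ - 1) (c₂ := b + s - 1) hn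
  have hK := twoK_mul_r (n := n) (j := j) (m₁ := m₁) (m₂ := m₂) hn
  have ht := coF_top (m := m₁) hm₁ hm₁j hn
  have hAs : ((m₁ - s : ℕ) : ℚ) = (m₁ : ℚ) - s := by rw [Nat.cast_sub hs₁]
  unfold gErr
  rw [mul_sub, mul_add, ← mul_assoc, ← mul_assoc, mul_comm _ ((m₁ - s : ℕ) : ℚ), mul_comm _ (s : ℚ), mul_assoc,
    mul_assoc, hA, hD, hK, hAs]
  linear_combination ht

/-- `c'·g_{c'−1} + (j + 1)·δ = (j + 1 − c')·f_{c'}` for every `c' < m` (at `c' = 0` this is `f_0 = δ`). -/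
theorem coF_col_all {n j m c' : ℕ} (hm : 1 ≤ m) (hmj : m ≤ j) (hn : 2 * j + 1 ≤ n) (hc : c' < m) :
    (c' : ℚ) * coG n j m (c' - 1) + ((j : ℚ) + 1) * coDel n j m = ((j : ℚ) + 1 - c') * coF n j m c' := by
  rcases Nat.eq_zero_or_pos c' with h0 | hpos
  · subst h0
    rw [coF_zero (m := m) hn]
    simp
  · exact coF_col hm hmj hn hpos hc

/-- **The correction of a row below the touched column `(#A, b, s)` sums to zero**:
`−gErr b/m₁ + (#B − b)·gBeta b + (n − j − #B − 1 + b)·gGamma b = 0` (`b + s < m₂`, `m₁ + b ≤ j + 1`). -/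
theorem corr_zero {n j m₁ m₂ s b : ℕ} (hm₁ : 1 ≤ m₁) (hm₁j : m₁ ≤ j) (hm₂ : 1 ≤ m₂) (hm₂j : m₂ ≤ j)
    (hn : 2 * j + 1 ≤ n) (hs₁ : s ≤ m₁) (hs₂ : s ≤ m₂) (hbs : b + s < m₂) (hbL : m₁ + b ≤ j + 1) :
    -gErr n j m₁ m₂ s b / (m₁ : ℚ) + (((m₂ - s : ℕ) : ℚ) - b) * gBeta n j m₁ m₂ s b +
      ((n : ℚ) - j - ((m₂ - s : ℕ) : ℚ) - 1 + b) * gGamma n j m₁ m₂ s b = 0 := by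
  have hr : (0 : ℚ) < ((n - j : ℕ) : ℚ) := by
    have : 1 ≤ n - j := by omega
    exact_mod_cast this
  have hrq : ((n - j : ℕ) : ℚ) = (n : ℚ) - j := by rw [Nat.cast_sub (by omega)]
  have hm : (0 : ℚ) < (m₁ : ℚ) := by exact_mod_cast hm₁
  have herr := gErr_eq (m₂ := m₂) (b := b) hm₁ hm₁j hn hs₁
  have hcol := coF_col_all (m := m₂) (c' := b + s) hm₂ hm₂j hn hbs
  have hB : ((m₂ - s : ℕ) : ℚ) = (m₂ : ℚ) - s := by rw [Nat.cast_sub hs₂]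
  have hA : ((m₁ - s : ℕ) : ℚ) = (m₁ : ℚ) - s := by rw [Nat.cast_sub hs₁]
  have hL : ((j + 1 - m₁ - b : ℕ) : ℚ) = (j : ℚ) + 1 - m₁ - b := by
    rw [Nat.cast_sub (by omega), Nat.cast_sub (by omega)]
    push_cast
    ring
  have hmb : ((m₂ - s - b : ℕ) : ℚ) = (m₂ : ℚ) - s - b := by
    rw [Nat.cast_sub (by omega), Nat.cast_sub hs₂]
  have hmb1 : ((m₂ - s + 1 - b : ℕ) : ℚ) = (m₂ : ℚ) - s + 1 - b := by
    rw [show m₂ - s + 1 - b = m₂ + 1 - (s + b) by omega, Nat.cast_sub (by omega)]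
    push_cast
    ring
  have hmb0 : (m₂ : ℚ) - s - b ≠ 0 := by
    have : (b : ℚ) + s + 1 ≤ m₂ := by exact_mod_cast (show b + s + 1 ≤ m₂ by omega)
    linarith
  have hmb10 : (m₂ : ℚ) - s + 1 - b ≠ 0 := by
    have : (b : ℚ) + s + 1 ≤ m₂ := by exact_mod_cast (show b + s + 1 ≤ m₂ by omega)
    linarith
  have hbs' : ((b + s : ℕ) : ℚ) = (b : ℚ) + s := by push_cast; ring
  rw [hbs'] at hcol
  -- `gErr` solved from the deficit form
  have hgE : gErr n j m₁ m₂ s b =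
      (((j : ℚ) + 1) * coDel n j m₂ - ((m₁ : ℚ) - s) * coF n j m₂ (b + s) + (s : ℚ) * coG n j m₂ (b + s - 1)) /
        ((n - j : ℕ) : ℚ) := by
    rw [eq_div_iff hr.ne', ← hA]
    linear_combination herr
  -- `b·f_{b+s−1}·E = b·(#B + 1 − b)·g_{b+s−1}` by the row identity of `C₂` at `b + s − 1`
  have hrowb : (b : ℚ) * coF n j m₂ (b + s - 1) * ((n : ℚ) - j - ((m₂ : ℚ) - s) - 1 + b) =
      (b : ℚ) * (((m₂ : ℚ) - s + 1 - b) * coG n j m₂ (b + s - 1)) := by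
    rcases Nat.eq_zero_or_pos b with h0 | hpos
    · subst h0
      simp
    · have hrow := coF_row (m := m₂) hm₂ hm₂j hn (c := b + s - 1) (by omega)
      have hbs1 : ((b + s - 1 : ℕ) : ℚ) = (b : ℚ) + s - 1 := by
        rw [Nat.cast_sub (by omega)]
        push_cast
        ring
      rw [hbs1] at hrow
      linear_combination (-(b : ℚ)) * hrow
  unfold gBeta gGamma
  rw [hL, hmb, hmb1, hB]
  have hD : ((n - j : ℕ) : ℚ) * (m₁ : ℚ) ≠ 0 := by positivity
  have hT1 : -gErr n j m₁ m₂ s b / (m₁ : ℚ) =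
      -(((j : ℚ) + 1) * coDel n j m₂ - ((m₁ : ℚ) - s) * coF n j m₂ (b + s) + (s : ℚ) * coG n j m₂ (b + s - 1)) /
        (((n - j : ℕ) : ℚ) * (m₁ : ℚ)) := by
    rw [hgE]
    field_simp
  have hT2 : ((m₂ : ℚ) - s - b) *
      (((j : ℚ) + 1 - m₁ - b) * coF n j m₂ (b + s) / (((n - j : ℕ) : ℚ) * (m₁ : ℚ) * ((m₂ : ℚ) - s - b))) =
      ((j : ℚ) + 1 - m₁ - b) * coF n j m₂ (b + s) / (((n - j : ℕ) : ℚ) * (m₁ : ℚ)) := by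
    field_simp
  have hT3 : ((n : ℚ) - j - ((m₂ : ℚ) - s) - 1 + b) *
      (-((b : ℚ) * coF n j m₂ (b + s - 1)) / (((n - j : ℕ) : ℚ) * (m₁ : ℚ) * ((m₂ : ℚ) - s + 1 - b))) =
      -((b : ℚ) * coG n j m₂ (b + s - 1)) / (((n - j : ℕ) : ℚ) * (m₁ : ℚ)) := by
    rw [show ((n : ℚ) - j - ((m₂ : ℚ) - s) - 1 + b) *
        (-((b : ℚ) * coF n j m₂ (b + s - 1)) / (((n - j : ℕ) : ℚ) * (m₁ : ℚ) * ((m₂ : ℚ) - s + 1 - b))) =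
        (-((b : ℚ) * coF n j m₂ (b + s - 1) * ((n : ℚ) - j - ((m₂ : ℚ) - s) - 1 + b))) /
          (((n - j : ℕ) : ℚ) * (m₁ : ℚ) * ((m₂ : ℚ) - s + 1 - b)) by ring]
    rw [div_eq_div_iff (mul_ne_zero hD hmb10) hD]
    linear_combination (-(((n - j : ℕ) : ℚ) * (m₁ : ℚ))) * hrowb
  rw [hT1, hT2, hT3, ← add_div, ← add_div, div_eq_zero_iff]
  left
  linear_combination (-1 : ℚ) * hcol

/-! ### The row identities -/

/-- **A type-I row `(#A − 1, b, s)`** (`b + 2 ≤ #B`, `m₁ + b ≤ j + 1`) sums to `1`, in the shape of the master lemma. -/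
theorem row_typeI {n j m₁ m₂ s b : ℕ} (hm₁ : 1 ≤ m₁) (hm₁j : m₁ ≤ j) (hm₂ : 1 ≤ m₂) (hm₂j : m₂ ≤ j)
    (hn : 2 * j + 1 ≤ n) (hs₁ : s + 1 ≤ m₁) (hs₂ : s ≤ m₂) (hb : b + 2 ≤ m₂ - s) (hbL : m₁ + b ≤ j + 1) :
    (((m₁ - s : ℕ) : ℚ) - ((m₁ - s - 1 : ℕ) : ℚ)) * w3A n j m₁ m₂ s (m₁ - s - 1) b s +
      (((m₂ - s : ℕ) : ℚ) - b) * w3B n j m₁ m₂ s (m₁ - s - 1) b s +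
      ((s : ℚ) - s) * w3D n j m₁ m₂ s (m₁ - s - 1) b s +
      ((n : ℚ) - j - ((m₁ - s : ℕ) : ℚ) - ((m₂ - s : ℕ) : ℚ) - s + ((m₁ - s - 1 : ℕ) : ℚ) + b + s) *
        w3R n j m₁ m₂ s (m₁ - s - 1) b s = 1 := by
  have hrow := sup3_row (n := n) (j := j) (m₁ := m₁) (m₂ := m₂) (s := s) (a := m₁ - s - 1) (b := b) (d := s)
    hm₁ hm₁j hm₂ hm₂j hn (by omega) hs₂ (by omega) (by omega)
  have hcorr := corr_zero (n := n) (j := j) (m₁ := m₁) (m₂ := m₂) (s := s) (b := b) hm₁ hm₁j hm₂ hm₂j hn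
    (by omega) hs₂ (by omega) hbL
  have e1 : m₁ - s - 1 + s = m₁ - 1 := by omega
  rw [e1] at hrow
  have c1 : ((m₁ - s - 1 : ℕ) : ℚ) = ((m₁ - s : ℕ) : ℚ) - 1 := by
    rw [Nat.cast_sub (by omega)]
    push_cast
    ring
  unfold w3A w3B w3D w3R
  split_ifs <;> try omega
  rw [c1] at hrow ⊢
  linear_combination hrow + hcorr

/-- **A type-II row `(#A, b, s − 1)`** (`1 ≤ s`, `b + 1 ≤ #B`, `m₁ + b ≤ j + 1`) sums to `1`. -/
theorem row_typeII {n j m₁ m₂ s b : ℕ} (hm₁ : 1 ≤ m₁) (hm₁j : m₁ ≤ j) (hm₂ : 1 ≤ m₂) (hm₂j : m₂ ≤ j)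
    (hn : 2 * j + 1 ≤ n) (hs : 1 ≤ s) (hs₁ : s ≤ m₁) (hs₂ : s ≤ m₂) (hb : b + 1 ≤ m₂ - s) (hbL : m₁ + b ≤ j + 1) :
    (((m₁ - s : ℕ) : ℚ) - ((m₁ - s : ℕ) : ℚ)) * w3A n j m₁ m₂ s (m₁ - s) b (s - 1) +
      (((m₂ - s : ℕ) : ℚ) - b) * w3B n j m₁ m₂ s (m₁ - s) b (s - 1) +
      ((s : ℚ) - ((s - 1 : ℕ) : ℚ)) * w3D n j m₁ m₂ s (m₁ - s) b (s - 1) +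
      ((n : ℚ) - j - ((m₁ - s : ℕ) : ℚ) - ((m₂ - s : ℕ) : ℚ) - s + ((m₁ - s : ℕ) : ℚ) + b + ((s - 1 : ℕ) : ℚ)) *
        w3R n j m₁ m₂ s (m₁ - s) b (s - 1) = 1 := by
  have hrow := sup3_row (n := n) (j := j) (m₁ := m₁) (m₂ := m₂) (s := s) (a := m₁ - s) (b := b) (d := s - 1)
    hm₁ hm₁j hm₂ hm₂j hn hs₁ hs₂ (by omega) (by omega)
  have hcorr := corr_zero (n := n) (j := j) (m₁ := m₁) (m₂ := m₂) (s := s) (b := b) hm₁ hm₁j hm₂ hm₂j hn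
    hs₁ hs₂ (by omega) hbL
  have e1 : m₁ - s + (s - 1) = m₁ - 1 := by omega
  have e2 : b + (s - 1) = b + s - 1 := by omega
  rw [e1, e2] at hrow
  have c1 : ((s - 1 : ℕ) : ℚ) = (s : ℚ) - 1 := by
    rw [Nat.cast_sub hs]
    push_cast
    ring
  unfold w3A w3B w3D w3R
  split_ifs <;> try omega
  rw [c1] at hrow ⊢
  linear_combination hrow + hcorr

/-- **The corner row `(#A − 1, #B − 1, s)`** (`#A + #B + s = j + 2`) sums to `1`. -/
theorem row_corner3 {n j m₁ m₂ s : ℕ} (hm₁j : m₁ ≤ j) (hm₂j : m₂ ≤ j) (hs₁ : s + 1 ≤ m₁) (hs₂ : s + 1 ≤ m₂)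
    (hsum : m₁ + m₂ - s = j + 2) (hn : 2 * j + 1 ≤ n) :
    (((m₁ - s : ℕ) : ℚ) - ((m₁ - s - 1 : ℕ) : ℚ)) * w3A n j m₁ m₂ s (m₁ - s - 1) (m₂ - s - 1) s +
      (((m₂ - s : ℕ) : ℚ) - ((m₂ - s - 1 : ℕ) : ℚ)) * w3B n j m₁ m₂ s (m₁ - s - 1) (m₂ - s - 1) s +
      ((s : ℚ) - s) * w3D n j m₁ m₂ s (m₁ - s - 1) (m₂ - s - 1) s +
      ((n : ℚ) - j - ((m₁ - s : ℕ) : ℚ) - ((m₂ - s : ℕ) : ℚ) - s + ((m₁ - s - 1 : ℕ) : ℚ) + ((m₂ - s - 1 : ℕ) : ℚ) + s) *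
        w3R n j m₁ m₂ s (m₁ - s - 1) (m₂ - s - 1) s = 1 := by
  have c1 : ((m₁ - s - 1 : ℕ) : ℚ) = ((m₁ - s : ℕ) : ℚ) - 1 := by
    rw [Nat.cast_sub (by omega)]
    push_cast
    ring
  have c2 : ((m₂ - s - 1 : ℕ) : ℚ) = ((m₂ - s : ℕ) : ℚ) - 1 := by
    rw [Nat.cast_sub (by omega)]
    push_cast
    ring
  have hρ : ((n - m₁ - m₂ + s : ℕ) : ℚ) = (n : ℚ) - j - 2 := by
    rw [show n - m₁ - m₂ + s = n - (j + 2) by omega, Nat.cast_sub (by omega)]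
    push_cast
    ring
  have hρ0 : (n : ℚ) - j - 2 ≠ 0 := by
    have : (j : ℚ) + 3 ≤ n := by exact_mod_cast (show j + 3 ≤ n by omega)
    linarith
  have hAB : ((m₁ - s : ℕ) : ℚ) + ((m₂ - s : ℕ) : ℚ) + s = (j : ℚ) + 2 := by
    rw [Nat.cast_sub (by omega), Nat.cast_sub (by omega)]
    have : ((m₁ + m₂ - s : ℕ) : ℚ) = (j : ℚ) + 2 := by exact_mod_cast hsum
    rw [Nat.cast_sub (by omega)] at this
    push_cast at this
    linarith
  have e1 : m₁ - s - 1 + s = m₁ - 1 := by omega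
  have e2 : m₂ - s - 1 + s = m₂ - 1 := by omega
  unfold w3A w3B w3D w3R
  split_ifs <;> try omega
  rw [e1, e2, c1, c2]
  unfold gCornerR
  rw [hρ]
  have hcoef : (n : ℚ) - j - ((m₁ - s : ℕ) : ℚ) - ((m₂ - s : ℕ) : ℚ) - s + (((m₁ - s : ℕ) : ℚ) - 1) +
      (((m₂ - s : ℕ) : ℚ) - 1) + s = (n : ℚ) - j - 2 := by ring
  rw [hcoef]
  field_simp
  ring

end PercRepro.PuncturedLYM
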